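import Summits.CriticalPhenomena.PercolationContinuityZ3.Theorems.PercNearOneGluingNoHeavyLowerTailMajorityGluingTypeBridgeLinRows
import Summits.CriticalPhenomena.PercolationContinuityZ3.Theorems.PercNearOneGluingNoHeavyLowerTailMajorityGluingTypeBridgeQuadRows
import Summits.CriticalPhenomena.PercolationContinuityZ3.Theorems.PercNearOneGluingNoHeavyLowerTailMajorityGluingTypeBridgeIsoRows
import Summits.CriticalPhenomena.PercolationContinuityZ3.Theorems.PercNearOneGluingNoHeavyLowerTailMajorityGluingTypeTableScaledBottom
import Summits.CriticalPhenomena.PercolationContinuityZ3.Theorems.PercNearOneGluingNoHeavyLowerTailMajorityGluingThreeOfFourWZero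
import Summits.CriticalPhenomena.PercolationContinuityZ3.Theorems.PercNearOneGluingNoHeavyLowerTailMajorityGluingSixHarris
import Summits.CriticalPhenomena.PercolationContinuityZ3.Theorems.PercNearOneGluingNoHeavyLowerTailMajorityGluingHubOnlyWeakAt
import HarnessLib

/-!
# `C(6) = 2`: majority gluing at `|A| = 6` loses exactly `2·max` — the weak percolation-EKR cell `(4,3)` on the whole range (lane prim-rate, constants-miner 1, gen 31; SUMMARY-M1-L2.md, CANDIDATES §GEN-3 … §GEN-31)

Support file for the closed crux `NoHeavyLowerTail` (stmt-CriticalPhenomena-4575), majority-gluing line.  THE TARGET OF THE LINE SINCE GEN 3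
(BENCH l.196/l.202, «C(6) = 2 ⟺ weak percolation-EKR at (4,3)», `…MajorityGluingHubOnlyWeakAt`): for every finite weighted graph, hub `a₀`,
four relays `T ∌ a₀` and `δ ∈ [0, 1/2]` bounding their cut probabilities,
  **`μ(at least three relays of T cut from a₀) ≤ δ/(1 − δ)`**   (`weakEKR43`):
for `δ ≥ 13/256` by van den Berg–Kahn log-supermodularity (`threeOfFour_count`, gen 3), and for `δ < 13/256` by the KERNEL `(4,3)` PROGRAMME —
the window `window_13_256` (gen 29) and the bottom `bottom_scaled` (gen 30) of the abstract 94-type programme (`weak43_cell`), whose row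
hypotheses are discharged for percolation by the type bridge of this generation (`Bridge.weakCell_small`: the vdBHK budget rows from BHK 2006
Thm 1.3, the van den Berg–Kahn rows from BK 2001 Thm 1.2, the isolation rows ISO₃/ISO₄/ISO₅ from the m-point isolation inequality).  Hence
(`majorityGluing_two_card_six`, via `HubOnly.majorityGluing_two_of_weakEKR_at`): for every weight function, observer `o`, hub `a₀ ∈ A`, `|A| = 6`
and `δ₀ ≥ max_{a∈A} μ(a ↮ a₀)`:  **`μ(o ↔ A) − 2·δ₀ ≤ μ(o ↔ a₀ ∧ 2N > 6)`** — the majority-gluing constant at `|A| = 6` IS `2` (sharp by the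
lane's 5-vertex path family, CANDIDATES §GEN-2).  No sorries, no named facts. [cite: KozmaNitzan2024, Conj. 1 (p. 3)] [cite: VandenbergKahn2001, Thm 1.2 (p. 123)]
-/
/-!
# The TYPE BRIDGE, part VIII: `SymLaw` for the law of the hub gadget and THE WEAK `(4,3)` CELL BELOW `13/256` AS A PERCOLATION THEOREM (lane prim-rate, constants-miner 1, gen 31; CANDIDATES §GEN-31)

Support file for the closed crux `NoHeavyLowerTail` (stmt-CriticalPhenomena-4575), majority-gluing line.  Parts I–VII give every row of
`HubOnly.TypeTable.SymLaw` (and the 27 `O`-rows) for the scale-free law `law w a v M` of a hub gadget with `M = μ(v 1 ↮ a)` the largest cut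
probability and the other relays labelled in decreasing order of their cut probabilities (`symLaw_law`).  Hence the lane's kernel theorem
`TypeTable.weak43_cell` (p441489; the window + the kernel bottom of the abstract `(4,3)` programme) APPLIES TO PERCOLATION:
* `weakCell_small` — hub `a`, four distinct relays `v 1, …, v 4` labelled as above, `0 < M = μ(v 1 ↮ a) ≤ 13/256`:
  `(1 − M)·μ(at least three of the four relays cut) ≤ M`.
No sorries. [cite: VandenbergHaggstromKahn2005, Thm. 1.3 (p. 6)]
-/

noncomputable section

namespace Summit.CriticalPhenomena.PercolationContinuityZ3.Theorems

open MeasureTheory Set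
open Literature.Probability.LatticeModels (prodBernoulli)
open Literature.Probability.Percolation

namespace HubOnly
namespace TypeTable

/-- The number of cut relays of the canonical type of a valid shape is the number of cut flags (kernel evaluation over the shapes). -/
theorem ncut_spec_bool : ∀ s12 s13 s14 s23 s24 s34 c1 c2 c3 c4 : Bool,
    (⟨s12, s13, s14, s23, s24, s34, c1, c2, c3, c4⟩ : Shape).valid = true →
    (⟨s12, s13, s14, s23, s24, s34, c1, c2, c3, c4⟩ : Shape).toType.ncut = c1.toNat + c2.toNat + c3.toNat + c4.toNat := by
  decide +kernel

/-- The number of cut relays of the canonical type of a valid shape. -/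
theorem ncut_spec (σ : Shape) (hσ : σ.valid = true) : σ.toType.ncut = σ.c1.toNat + σ.c2.toNat + σ.c3.toNat + σ.c4.toNat := by
  obtain ⟨s12, s13, s14, s23, s24, s34, c1, c2, c3, c4⟩ := σ
  exact ncut_spec_bool s12 s13 s14 s23 s24 s34 c1 c2 c3 c4 hσ

namespace Bridge

open Refresh
open scoped Classical

variable {n : ℕ}

/-- **`SymLaw 0 M (law)` FOR THE HUB GADGET.**  Hub `a`, distinct relays `v 1, …, v 4 ≠ a` with `μ(v x ↮ a) ≤ M := μ(v 1 ↮ a)`, `0 < M`: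
the scale-free law of the gadget satisfies every symmetric hypothesis of the window programme at grid index `0`. -/
theorem symLaw_law (w : Sym2 (Fin n) → unitInterval) (a : Fin n) (v : ℕ → Fin n) (hv : ∀ x ∈ [1, 2, 3, 4], v x ≠ a)
    (hinj : ∀ x ∈ [1, 2, 3, 4], ∀ y ∈ [1, 2, 3, 4], v x = v y → x = y) {M : ℝ} (hM : 0 < M)
    (hM1 : (prodBernoulli w).real {ω : BondConfig (Fin n) | ¬ (openGraph ω).Reachable a (v 1)} = M)
    (hδ : ∀ x ∈ [2, 3, 4], (prodBernoulli w).real {ω : BondConfig (Fin n) | ¬ (openGraph ω).Reachable a (v x)} ≤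
      (prodBernoulli w).real {ω : BondConfig (Fin n) | ¬ (openGraph ω).Reachable a (v 1)}) :
    SymLaw 0 M (law w a v M) where
  nonneg := law_nonneg w a v hM
  linRows := linFree_law w a v hv hinj hM hδ
  norm := by
    have h := lin_ind_law w a v hv M (fun τ => τ.cut 1)
    have hset : {ω : BondConfig (Fin n) | (typeOf a v ω).cut 1 = true} = {ω | ¬ (openGraph ω).Reachable a (v 1)} := by
      ext ω; rw [mem_setOf_eq, typeOf_cut a v hv ω 1 (by simp), decide_eq_true_eq]; rfl
    rw [hset, hM1, div_self hM.ne'] at h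
    exact le_of_eq h
  hub := hub_law w a v hv hM
  rel := rel_law w a v hv hM
  Mpos := hM
  Mle := by
    have : (2 : ℝ) ^ (-((0 : ℕ) : ℝ) / 32) = 1 := by norm_num
    rw [this, ← hM1]; exact measureReal_le_one
  isoH := isoH_law w a v hv hinj hM
  isoR := isoR_law w a v hv hinj hM
  iso4 := iso4_law w a v hv hinj hM
  isoH4 := isoH4_law w a v hv hinj hM
  iso5 := iso5_law w a v hv hinj hM

/-- The count of cut relays of the type is the count of cut relays among `v 1, …, v 4`. -/
theorem ncut_typeOf (a : Fin n) (v : ℕ → Fin n) (hv : ∀ x ∈ [1, 2, 3, 4], v x ≠ a)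
    (hinj : ∀ x ∈ [1, 2, 3, 4], ∀ y ∈ [1, 2, 3, 4], v x = v y → x = y) (ω : BondConfig (Fin n)) :
    (typeOf a v ω).ncut = (({v 1, v 2, v 3, v 4} : Finset (Fin n)).filter fun u => ¬ (openGraph ω).Reachable a u).card := by
  have hval := shapeOf_valid a v hv ω
  have hspec : (typeOf a v ω).ncut = ((shapeOf a v ω).c1).toNat + ((shapeOf a v ω).c2).toNat + ((shapeOf a v ω).c3).toNat +
      ((shapeOf a v ω).c4).toNat := ncut_spec _ hval
  rw [hspec]
  have h12 : v 1 ≠ v 2 := fun h => absurd (hinj 1 (by simp) 2 (by simp) h) (by decide)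
  have h13 : v 1 ≠ v 3 := fun h => absurd (hinj 1 (by simp) 3 (by simp) h) (by decide)
  have h14 : v 1 ≠ v 4 := fun h => absurd (hinj 1 (by simp) 4 (by simp) h) (by decide)
  have h23 : v 2 ≠ v 3 := fun h => absurd (hinj 2 (by simp) 3 (by simp) h) (by decide)
  have h24 : v 2 ≠ v 4 := fun h => absurd (hinj 2 (by simp) 4 (by simp) h) (by decide)
  have h34 : v 3 ≠ v 4 := fun h => absurd (hinj 3 (by simp) 4 (by simp) h) (by decide)
  rw [PropW0.card_filter_insert (by simp [h12, h13, h14]), PropW0.card_filter_insert (by simp [h23, h24]),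
    PropW0.card_filter_insert (by simp [h34]), Finset.filter_singleton]
  have e : ∀ x ∈ [1, 2, 3, 4], ((shapeOf a v ω).cutf x).toNat = if ¬ (openGraph ω).Reachable a (v x) then 1 else 0 := by
    intro x hx
    rw [shapeOf_cutf a v ω x hx]; by_cases h : (openGraph ω).Reachable a (v x) <;> simp [h]
  have e1 := e 1 (by simp); have e2 := e 2 (by simp); have e3 := e 3 (by simp); have e4 := e 4 (by simp)
  simp only [Shape.cutf] at e1 e2 e3 e4
  rw [e1, e2, e3, e4]
  by_cases h4 : ¬ (openGraph ω).Reachable a (v 4) <;> simp [h4] <;> ring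

/-- **THE WEAK `(4,3)` CELL BELOW `13/256` FOR PERCOLATION.**  Hub `a`, distinct relays `v 1, …, v 4 ≠ a` labelled so that
`M = μ(v 1 ↮ a) ≥ μ(v 2 ↮ a) ≥ μ(v 3 ↮ a) ≥ μ(v 4 ↮ a)`, with `0 < M ≤ 13/256`:  `(1 − M)·μ(≥ 3 of the four relays cut) ≤ M`.  The lane's
kernel theorem `weak43_cell` (window + kernel bottom of the abstract programme) applied to the law of the gadget (`symLaw_law`, `linOrd_law`).
[cite: VandenbergHaggstromKahn2005, Thm. 1.3 (p. 6)] -/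
theorem weakCell_small (w : Sym2 (Fin n) → unitInterval) (a : Fin n) (v : ℕ → Fin n) (hv : ∀ x ∈ [1, 2, 3, 4], v x ≠ a)
    (hinj : ∀ x ∈ [1, 2, 3, 4], ∀ y ∈ [1, 2, 3, 4], v x = v y → x = y) {M : ℝ} (hM : 0 < M) (hM13 : M ≤ 13 / 256)
    (hM1 : (prodBernoulli w).real {ω : BondConfig (Fin n) | ¬ (openGraph ω).Reachable a (v 1)} = M)
    (h21 : (prodBernoulli w).real {ω : BondConfig (Fin n) | ¬ (openGraph ω).Reachable a (v 2)} ≤ M)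
    (h32 : (prodBernoulli w).real {ω : BondConfig (Fin n) | ¬ (openGraph ω).Reachable a (v 3)} ≤
      (prodBernoulli w).real {ω : BondConfig (Fin n) | ¬ (openGraph ω).Reachable a (v 2)})
    (h43 : (prodBernoulli w).real {ω : BondConfig (Fin n) | ¬ (openGraph ω).Reachable a (v 4)} ≤
      (prodBernoulli w).real {ω : BondConfig (Fin n) | ¬ (openGraph ω).Reachable a (v 3)}) :
    (1 - M) * (prodBernoulli w).real {ω : BondConfig (Fin n) |
        3 ≤ (({v 1, v 2, v 3, v 4} : Finset (Fin n)).filter fun u => ¬ (openGraph ω).Reachable a u).card} ≤ M := by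
  set μ := prodBernoulli w with hμ
  have hδ : ∀ x ∈ [2, 3, 4], μ.real {ω : BondConfig (Fin n) | ¬ (openGraph ω).Reachable a (v x)} ≤
      μ.real {ω : BondConfig (Fin n) | ¬ (openGraph ω).Reachable a (v 1)} := by
    intro x hx
    simp only [List.mem_cons, List.not_mem_nil, or_false] at hx
    rcases hx with rfl | rfl | rfl
    · rw [hM1]; exact h21
    · rw [hM1]; exact h32.trans h21
    · rw [hM1]; exact (h43.trans h32).trans h21
  have L := symLaw_law w a v hv hinj hM hM1 hδ
  have O := linOrd_law w a v hv hinj hM h32 h43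
  have h13 : (((13 / 256 : ℚ)) : ℝ) = 13 / 256 := by norm_num
  have key := weak43_cell L O (by rw [h13]; exact hM13)
  rw [E_law w a v hv] at key
  have hX : {ω : BondConfig (Fin n) | decide (3 ≤ (typeOf a v ω).ncut) = true} =
      {ω | 3 ≤ (({v 1, v 2, v 3, v 4} : Finset (Fin n)).filter fun u => ¬ (openGraph ω).Reachable a u).card} := by
    ext ω; rw [mem_setOf_eq, decide_eq_true_eq, ncut_typeOf a v hv hinj ω]; rfl
  have h1 : {ω : BondConfig (Fin n) | (typeOf a v ω).cut 1 = true} = {ω | ¬ (openGraph ω).Reachable a (v 1)} := by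
    ext ω; rw [mem_setOf_eq, typeOf_cut a v hv ω 1 (by simp), decide_eq_true_eq]; rfl
  rw [hX, h1, hM1] at key
  have hM1' : M < 1 := by linarith
  -- `(1 − M)·(X − M)/M ≤ M` ⟹ `(1 − M)·X ≤ M`
  have := mul_le_mul_of_nonneg_left key hM.le
  have hXnn : 0 ≤ μ.real {ω : BondConfig (Fin n) | 3 ≤ (({v 1, v 2, v 3, v 4} : Finset (Fin n)).filter
      fun u => ¬ (openGraph ω).Reachable a u).card} := measureReal_nonneg
  field_simp at this
  nlinarith [this, hXnn]

end Bridge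
end TypeTable
end HubOnly
end Summit.CriticalPhenomena.PercolationContinuityZ3.Theorems


namespace Summit.CriticalPhenomena.PercolationContinuityZ3.Theorems

open MeasureTheory Set
open Literature.Probability.LatticeModels (prodBernoulli)
open Literature.Probability.Percolation
open scoped Classical

namespace HubOnly

variable {n : ℕ}

/-- **THE WEAK PERCOLATION-EKR CELL `(4,3)` ON THE WHOLE RANGE.**  For every finite weighted graph, hub `a₀`, four relays `T ∌ a₀` and
`0 ≤ δ ≤ 1/2` with `μ(v ↮ a₀) ≤ δ` on `T`:  `μ(≥ 3 of the four relays cut) ≤ δ/(1 − δ)`.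
[cite: VandenbergKahn2001, Thm 1.2 (p. 123)] [cite: VandenbergHaggstromKahn2005, Thm. 1.3 (p. 6)] -/
theorem weakEKR43 (w : Sym2 (Fin n) → unitInterval) (a₀ : Fin n) (T : Finset (Fin n)) (hT : T.card = 4) (haT : a₀ ∉ T) (δ : ℝ)
    (hδ0 : 0 ≤ δ) (hδ1 : δ ≤ 1 / 2) (hδT : ∀ u ∈ T, (prodBernoulli w).real (openConn u a₀ : Set (BondConfig (Fin n)))ᶜ ≤ δ) :
    (prodBernoulli w).real {ω : BondConfig (Fin n) | 3 ≤ (T.filter fun u => ω ∉ openConn u a₀).card} ≤ δ / (1 - δ) := by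
  set μ := prodBernoulli w with hμ
  have h1δ : 0 < 1 - δ := by linarith
  by_cases hbig : 13 / 256 ≤ δ
  · -- van den Berg–Kahn regime
    have h := threeOfFour_count w a₀ T hT δ hδT
    have : 256 / 243 * δ ≤ δ / (1 - δ) := by
      rw [le_div_iff₀ h1δ]; nlinarith
    exact h.trans this
  push Not at hbig
  -- the cut probabilities, hub-first orientation
  set d : Fin n → ℝ := fun u => μ.real {ω : BondConfig (Fin n) | ¬ (openGraph ω).Reachable a₀ u} with hd
  have hdconn : ∀ u, μ.real (openConn u a₀ : Set (BondConfig (Fin n)))ᶜ = d u := by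
    intro u; congr 1; ext ω
    simp only [mem_compl_iff, openConn, mem_setOf_eq]
    exact ⟨fun h hr => h hr.symm, fun h hr => h hr.symm⟩
  have hdδ : ∀ u ∈ T, d u ≤ δ := fun u hu => (hdconn u) ▸ hδT u hu
  -- sort the relays by cut probability
  have hTne : T.Nonempty := by rw [← Finset.card_pos, hT]; norm_num
  obtain ⟨v1, h1T, h1max⟩ := Finset.exists_max_image T d hTne
  have hT1 : (T.erase v1).card = 3 := by rw [Finset.card_erase_of_mem h1T, hT]
  obtain ⟨v2, h2T', h2max⟩ := Finset.exists_max_image (T.erase v1) d (by rw [← Finset.card_pos, hT1]; norm_num)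
  have hT2 : ((T.erase v1).erase v2).card = 2 := by rw [Finset.card_erase_of_mem h2T', hT1]
  obtain ⟨v3, h3T', h3max⟩ := Finset.exists_max_image ((T.erase v1).erase v2) d (by rw [← Finset.card_pos, hT2]; norm_num)
  have hT3 : (((T.erase v1).erase v2).erase v3).card = 1 := by rw [Finset.card_erase_of_mem h3T', hT2]
  obtain ⟨v4, hv4⟩ := Finset.card_eq_one.1 hT3
  have h4T' : v4 ∈ ((T.erase v1).erase v2).erase v3 := by rw [hv4]; exact Finset.mem_singleton_self _
  -- memberships and distinctness
  have h2T : v2 ∈ T := Finset.mem_of_mem_erase h2T'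
  have h3T : v3 ∈ T := Finset.mem_of_mem_erase (Finset.mem_of_mem_erase h3T')
  have h4T : v4 ∈ T := Finset.mem_of_mem_erase (Finset.mem_of_mem_erase (Finset.mem_of_mem_erase h4T'))
  have h21 : v2 ≠ v1 := Finset.ne_of_mem_erase h2T'
  have h32 : v3 ≠ v2 := Finset.ne_of_mem_erase h3T'
  have h31 : v3 ≠ v1 := Finset.ne_of_mem_erase (Finset.mem_of_mem_erase h3T')
  have h43 : v4 ≠ v3 := Finset.ne_of_mem_erase h4T'
  have h42 : v4 ≠ v2 := Finset.ne_of_mem_erase (Finset.mem_of_mem_erase h4T')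
  have h41 : v4 ≠ v1 := Finset.ne_of_mem_erase (Finset.mem_of_mem_erase (Finset.mem_of_mem_erase h4T'))
  have hd21 : d v2 ≤ d v1 := h1max v2 h2T
  have hd32 : d v3 ≤ d v2 := h2max v3 (Finset.mem_of_mem_erase h3T')
  have hd43 : d v4 ≤ d v3 := h3max v4 (Finset.mem_of_mem_erase h4T')
  have hTeq : T = ({v1, v2, v3, v4} : Finset (Fin n)) := by
    symm
    apply Finset.eq_of_subset_of_card_le
    · intro u hu
      simp only [Finset.mem_insert, Finset.mem_singleton] at hu
      rcases hu with rfl | rfl | rfl | rfl <;> assumption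
    · rw [hT, Finset.card_insert_of_notMem (by simp [h21.symm, h31.symm, h41.symm]),
        Finset.card_insert_of_notMem (by simp [h32.symm, h42.symm]), Finset.card_pair h43.symm]
  -- the relay map
  set v : ℕ → Fin n := fun k => if k = 1 then v1 else if k = 2 then v2 else if k = 3 then v3 else v4 with hvdef
  have hv1 : v 1 = v1 := by simp [hvdef]
  have hv2 : v 2 = v2 := by simp [hvdef]
  have hv3 : v 3 = v3 := by simp [hvdef]
  have hv4 : v 4 = v4 := by simp [hvdef]
  have hne : ∀ u ∈ T, u ≠ a₀ := fun u hu h => haT (h ▸ hu)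
  have hv : ∀ x ∈ [1, 2, 3, 4], v x ≠ a₀ := by
    intro x hx; simp only [List.mem_cons, List.not_mem_nil, or_false] at hx
    rcases hx with rfl | rfl | rfl | rfl
    · rw [hv1]; exact hne _ h1T
    · rw [hv2]; exact hne _ h2T
    · rw [hv3]; exact hne _ h3T
    · rw [hv4]; exact hne _ h4T
  have hinj : ∀ x ∈ [1, 2, 3, 4], ∀ y ∈ [1, 2, 3, 4], v x = v y → x = y := by
    intro x hx y hy hxy
    simp only [List.mem_cons, List.not_mem_nil, or_false] at hx hy
    rcases hx with rfl | rfl | rfl | rfl <;> rcases hy with rfl | rfl | rfl | rfl <;>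
      simp only [hv1, hv2, hv3, hv4] at hxy <;> first | rfl | exact absurd hxy ‹_› | exact absurd hxy.symm ‹_›
  -- the target event in hub-first orientation
  have hX : {ω : BondConfig (Fin n) | 3 ≤ (T.filter fun u => ω ∉ openConn u a₀).card} =
      {ω | 3 ≤ (({v 1, v 2, v 3, v 4} : Finset (Fin n)).filter fun u => ¬ (openGraph ω).Reachable a₀ u).card} := by
    ext ω; simp only [mem_setOf_eq, hTeq, hv1, hv2, hv3, hv4]
    have : (({v1, v2, v3, v4} : Finset (Fin n)).filter fun u => ω ∉ openConn u a₀) =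
        ({v1, v2, v3, v4} : Finset (Fin n)).filter fun u => ¬ (openGraph ω).Reachable a₀ u := by
      refine Finset.filter_congr fun u _ => ?_
      simp only [openConn, mem_setOf_eq]
      exact ⟨fun h hr => h hr.symm, fun h hr => h hr.symm⟩
    rw [this]
  rw [hX]
  set M := d v1 with hMdef
  have hMδ : M ≤ δ := hdδ v1 h1T
  by_cases hM0 : M = 0
  · -- degenerate: every relay is a.s. joined; `{≥ 3 cut} ⊆ {v1 cut} ∪ {v2 cut}`
    have hsub : {ω : BondConfig (Fin n) | 3 ≤ (({v 1, v 2, v 3, v 4} : Finset (Fin n)).filter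
        fun u => ¬ (openGraph ω).Reachable a₀ u).card} ⊆
        {ω | ¬ (openGraph ω).Reachable a₀ v1} ∪ {ω | ¬ (openGraph ω).Reachable a₀ v2} := by
      intro ω hω
      by_contra hc
      simp only [mem_union, mem_setOf_eq, not_or, not_not] at hc
      simp only [mem_setOf_eq, hv1, hv2, hv3, hv4] at hω
      have hle : (({v1, v2, v3, v4} : Finset (Fin n)).filter fun u => ¬ (openGraph ω).Reachable a₀ u) ⊆ {v3, v4} := by
        intro u hu
        rw [Finset.mem_filter] at hu
        simp only [Finset.mem_insert, Finset.mem_singleton] at hu ⊢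
        rcases hu.1 with rfl | rfl | rfl | rfl
        · exact absurd hc.1 hu.2
        · exact absurd hc.2 hu.2
        · exact Or.inl rfl
        · exact Or.inr rfl
      have := (Finset.card_le_card hle).trans (Finset.card_le_two)
      omega
    have hd2 : d v2 = 0 := le_antisymm (hM0 ▸ hd21) measureReal_nonneg
    calc μ.real _ ≤ μ.real ({ω | ¬ (openGraph ω).Reachable a₀ v1} ∪ {ω | ¬ (openGraph ω).Reachable a₀ v2}) :=
          measureReal_mono hsub
      _ ≤ d v1 + d v2 := measureReal_union_le _ _
      _ = 0 := by rw [← hMdef, hM0, hd2, add_zero]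
      _ ≤ δ / (1 - δ) := div_nonneg hδ0 h1δ.le
  · have hMpos : 0 < M := lt_of_le_of_ne measureReal_nonneg (Ne.symm hM0)
    have hM13 : M ≤ 13 / 256 := by linarith
    have key := TypeTable.Bridge.weakCell_small w a₀ v hv hinj hMpos hM13 (by rw [hv1]) (by rw [hv2]; exact hd21)
      (by rw [hv2, hv3]; exact hd32) (by rw [hv3, hv4]; exact hd43)
    have h1M : 0 < 1 - M := by linarith
    have hXle : μ.real {ω : BondConfig (Fin n) | 3 ≤ (({v 1, v 2, v 3, v 4} : Finset (Fin n)).filter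
        fun u => ¬ (openGraph ω).Reachable a₀ u).card} ≤ M / (1 - M) := by
      rw [le_div_iff₀ h1M]; linarith
    have hmono : M / (1 - M) ≤ δ / (1 - δ) := by
      rw [div_le_div_iff₀ h1M h1δ]; nlinarith
    exact hXle.trans hmono

/-- **`C(6) = 2`: MAJORITY GLUING AT `|A| = 6` WITH LOSS `2·δ₀`** for every finite weighted graph, observer `o`, hub `a₀ ∈ A`, `|A| = 6` and
`δ₀ ≥ max_{a∈A} μ(a ↮ a₀)`:  `μ(o ↔ A) − 2·δ₀ ≤ μ(o ↔ a₀ ∧ 2N > 6)` (`N` = number of `a ∈ A` joined to `o`).  The conjectured value of the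
lane's table (SUMMARY-M1-L2.md: `C(4) = C(5) = 2` kernel, `C(6) ∈ [2, 499/243]` before this file) — via the weak `(4,3)` cell `weakEKR43` and
`HubOnly.majorityGluing_two_of_weakEKR_at`. [cite: KozmaNitzan2024, Conj. 1 (p. 3)] -/
theorem majorityGluing_two_card_six (w : Sym2 (Fin n) → unitInterval) (A : Finset (Fin n)) (o a₀ : Fin n) (δ₀ : ℝ)
    (ha₀ : a₀ ∈ A) (hA : A.card = 6) (hδ₀ : ∀ a ∈ A, (prodBernoulli w).real (openConn a a₀ : Set (BondConfig (Fin n)))ᶜ ≤ δ₀) :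
    (prodBernoulli w).real (⋃ a ∈ A, openConn o a) - 2 * δ₀ ≤
      (prodBernoulli w).real {ω : BondConfig (Fin n) | ω ∈ openConn o a₀ ∧
          A.card < 2 * (A.filter fun a => ω ∈ openConn o a).card} := by
  refine majorityGluing_two_of_weakEKR_at w A o a₀ δ₀ ha₀ ?_ hδ₀
  intro p _ T δ haT _ hTcard hδ0 hδ1 hδT
  have hT : T.card = 4 := by rw [hA] at hTcard; omega
  have h3 : (A.card + 1) / 2 = 3 := by rw [hA]
  rw [h3]
  exact weakEKR43 p a₀ T hT haT δ hδ0 hδ1 hδT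

end HubOnly
end Summit.CriticalPhenomena.PercolationContinuityZ3.Theorems
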